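import Literature.AnabelianGeometry.EtaleTheta.Discharge.Sec5Thm57HK4famEOfProducedShadowHsepPow
import Literature.AnabelianGeometry.EtaleTheta.Discharge.Sec5Thm57HK4famEOfShadowByName

/-!
# [EtTh] §5, Theorem 5.7 — FINAL KNIT v7 at the tower OF THE SETTING: Thm. 5.6 at each member BY NAME (the K4 junction book at the
# level-`M` rigidity data), `γ̄_M` INDUCED by `γ`, separation exponent `2·l` (pp. 324–334 / PDF pp. 98–108)

Mochizuki, *The étale theta function and its Frobenioid-theoretic manifestations*, Publ. RIMS **45** (2009)
[cite: MochizukiEtTh2009, Thm 5.7 p.329–330 (PDF pp.103–104); Thm 5.6 p.328–329 (PDF pp.102–103); Cor 2.19 (iii) p.291 (PDF p.65); Cor 2.18 (i)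
p.285–286 (PDF pp.59–60); Def 5.4 p.327 (PDF p.101); Thm 5.10 (ii) p.334 (PDF p.108)].  abc-iut cell, layer L2, node `EtTh:Thm5.7`; seat abc-iut-f-123
(gen 9), abc-iut-L2-lead R1311/R1325/R1359 «THM57-RESIDUAL-(3)» FILE 2, shape «BY-NAME» (R1325: «a displayed model-specific clause (4) traded for
Thm 5.6's OWN input list BY NAME — print's Thm 5.7 proof runs through Thm 5.6»).  PROOF-ONLY (0 definitions, 0 instances, 0 notation, no new named
fact; nothing landed is edited or restated).

WHAT.  abc-iut-L2-d4's leanest (C)-display `…_of_mlf_of_kernel_of_hsepPow_hK4famE′` (p511909) carries per member `(a, b, w)` the binder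
`hK4famE′ = {(4) (K4m) at b} ∧ {(3) shadow law of every PRODUCED base shadow}` and the étale shadow `(γ, γ_μ)` as FREE data glued by `hγμχ`, `hγμred`.
`thetaRootPreservedAll_ofThetaSettingYddFamily_final_v7_byName_of_hsepPow` is that display (same `(T, hT)` device,
same binders) with the §5 ↔ §2 dictionary identification `ι` PINNED to the identity (`hιid`; the §5 and §2 data share `Π^tp_X̲̲` on the nose), with (i) `γ_μ` INDUCED by `γ` on
`(l·Δ_Θ) ⊗ ℤ/M` (`hind`, the hypothesis shape of the typed `Cor219_iii`; `hγμχ`/`hγμred` STRUCK — p510157; `hstd` is then a constraint on `γ`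
alone at the induced action, abc-iut-L2-d4 note (n2)); (ii) **(4) NO LONGER A BINDER** — PROVED at every member from THE K4 JUNCTION BOOK BY NAME
(abc-iut-w5-d051's head p487842 through p511389) on the §5 datum `𝔉_M` over the LEVEL-`M` RIGIDITY DATA `RD_M := Cu.rigidData (τ.mod M) …`:
per level the v2 subquotient record `P_M` + two pins, the Kummer-determined rigidity family `(ρ_M, hB_M, hKD_M)` (`hB_M` DISPLAYED at the level
stub, R1325), the Δ-transport `aΨ_M`; per member «Thm. 5.6 at the transport» `hT56` = a base shadow `θ′` with T56-L09c, (K4β) at `b` and ITS shadow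
law against the ONE tower `γ` (= residual (3) for `θ′`); DISCHARGED INSIDE: the descent of `γ` (p438441 + uniqueness of the induced family), `hH`
(`stabilizer_base_comap_le_PiYdd`), Cor. 2.18 (i) at every level from the ONE `h218i` (`cor218_i_rigidData_iff`), `Facts` along the stub
(`facts_levelStub_of_atLevel`) — all inside FILE 2a `hK4famE'_of_shadow_byName`; (iii) residual (3) for the PRODUCED base shadows kept (`hK4famS` = `hK4famE′` minus (4)).
TOKEN (abc-iut-L2-lead R1325/R1359, pre-drafted): «(C)-display v7: γμ := level-M descent of γ (laws THEOREMS); (4) (K4m)@b DISCHARGED from the K4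
junction book at 𝔉_{RD_M} (p487842/p450400-galois) ⟸ Thm 5.6's input list BY NAME; residual displayed = {(3) shadow law of every produced base shadow
vs the ONE tower γ} + Thm 5.6 inputs BY NAME + hB_M; hH, descent DISCHARGED».
HONEST FRAMING: kernel-checked substitutions into landed theorems for data so parametrised (no `TemperedFrobenioid` of an actual curve is constructed in
the tree); the K4-book inputs, `hB_M`, F-0620 / `Prop15iii` / the F-0652 SHAPE are DISPLAYED binders or FACT-policy labels, none asserted inhabited at
a curve (GAP G-w4d042g3-1); [EtTh] is refereed; typed ≠ discharged — PROVED modulo the displayed binders; no side taken on [IUTchIII] Cor. 3.12;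
nothing here asserts abc proved or refuted.
-/

noncomputable section

namespace Literature.AnabelianGeometry.EtaleTheta

open CategoryTheory Opposite FrobenioidCyclotomicRigidity Literature.AlgebraicGeometry.Frobenioids Literature.AnabelianGeometry.SemiGraphs
  Literature.AnabelianGeometry.SemiGraphs.GaloisObjects
open Literature.AlgebraicGeometry.Frobenioids.QuasiTemperoid (stabilizerSubgroup)

universe w v v' u u' u₀ v₀ u₁ v₁

namespace ThetaFrobenioidTower

section Setting

variable {p : ℕ} [Fact p.Prime] {DS : ThetaSetting p} {ES : DS.EtaleThetaData} {l' : ℕ} (Cu : ES.DoubleUnderline l')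
  {e' : DS.toTemperedCurve.GroupLevelData} {Es : Set ℕ+} (τ : DS.CyclotomeTower l' Es) (hC : DS.Compat) (hS : DS.Sec2Hyps)
  {D₀ : Type} [Category.{v₀} D₀] {T₀ : RealifiedDivisorMonoids (D₀ := D₀) treeMonoidVocab.{0}}
  {VD : FrdICatStub.{1, 0, 0} (ConnectedPart (BTemp (Cu.temperedArithmeticGroup e').Pi))}
  {tf : TemperedFrobenioid T₀ (ConnectedPart (BTemp (Cu.temperedArithmeticGroup e').Pi)) VD} {hZ : tf.monoidType = MonoidType.Z}
  {hP : ∀ A : (ConnectedPart (BTemp (Cu.temperedArithmeticGroup e').Pi))ᵒᵖ, IsPerfect (tf.Φ.carrier A)}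
  {NH : Subgroup (Field.absoluteGaloisGroup DS.K) → tf.category → ℕ+ → Prop}
  {pullFrac : ∀ {A A' : (BiKummerSetting.mkOfConnectedTemperoidYddTower (Cu.temperedArithmeticGroup e') tf hZ hP NH (Cu.thetaEnvTower τ hC hS)
    (ContinuousMulEquiv.refl _)).C} (_ : A' ⟶ A), (BiKummerSetting.mkOfConnectedTemperoidYddTower (Cu.temperedArithmeticGroup e') tf hZ hP NH
    (Cu.thetaEnvTower τ hC hS) (ContinuousMulEquiv.refl _)).biratUnits A → (BiKummerSetting.mkOfConnectedTemperoidYddTower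
    (Cu.temperedArithmeticGroup e') tf hZ hP NH (Cu.thetaEnvTower τ hC hS) (ContinuousMulEquiv.refl _)).biratUnits A'}
  {θ : (BiKummerSetting.mkOfConnectedTemperoidYddTower (Cu.temperedArithmeticGroup e') tf hZ hP NH (Cu.thetaEnvTower τ hC hS)
    (ContinuousMulEquiv.refl _)).biratUnits (BiKummerSetting.mkOfConnectedTemperoidYddTower (Cu.temperedArithmeticGroup e') tf hZ hP NH
    (Cu.thetaEnvTower τ hC hS) (ContinuousMulEquiv.refl _)).Aodot}
  {Bl : (BiKummerSetting.mkOfConnectedTemperoidYddTower (Cu.temperedArithmeticGroup e') tf hZ hP NH (Cu.thetaEnvTower τ hC hS)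
    (ContinuousMulEquiv.refl _)).C}
  {Pl : (BiKummerSetting.mkOfConnectedTemperoidYddTower (Cu.temperedArithmeticGroup e') tf hZ hP NH (Cu.thetaEnvTower τ hC hS)
    (ContinuousMulEquiv.refl _)).FractionPair θ Bl}
  {Rl : (BiKummerSetting.mkOfConnectedTemperoidYddTower (Cu.temperedArithmeticGroup e') tf hZ hP NH (Cu.thetaEnvTower τ hC hS)
    (ContinuousMulEquiv.refl _)).NthRoot θ Pl Cu.lPNat pullFrac}
  (h : ModelFrobenioid.Hypotheses tf.divisorMonoid tf.ratFnFunctor)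
  (Q : FrobenioidTheta.ThetaSubquotientStub.{0} (ConnectedPart (BTemp (Cu.temperedArithmeticGroup e').Pi)))
  (R : ∀ N : ℕ+, (BiKummerSetting.mkOfConnectedTemperoidYddTower (Cu.temperedArithmeticGroup e') tf hZ hP NH (Cu.thetaEnvTower τ hC hS)
    (ContinuousMulEquiv.refl _)).NthRoot Rl.root Rl.pair N pullFrac)
  (K' : Type) [Field K'] {X₀ : ConnectedPart (BTemp (Cu.temperedArithmeticGroup e').Pi)}
  (hX₀ : ∀ Y : ConnectedPart (BTemp (Cu.temperedArithmeticGroup e').Pi), Subsingleton (Y ⟶ X₀))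
  (t : ∀ N : ℕ+, (R N).BN.base ⟶ X₀) (c₀ : K'ˣ →* (tf.ratFnFunctor.obj (op X₀))ˣ)
  (hc₀ : Function.Injective c₀) (ht : ∀ N : ℕ+, Function.Injective (tf.ratFnFunctor.map (t N).op).hom)
  (hinvc : ∀ (N : ℕ+) (g : Aut (R N).AN.base), pull tf.divisorMonoid g.hom (ModelFrobenioid.div (R N).pair.num) = ModelFrobenioid.div (R
    N).pair.num)
  (hinvp : ∀ (N : ℕ+) (y : (Cu.thetaEnvTower τ hC hS).PiX), y ∈ (Cu.thetaEnvTower τ hC hS).PiYdd → pull tf.divisorMonoid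
    ((BiKummerSetting.mkOfConnectedTemperoidYddTower (Cu.temperedArithmeticGroup e') tf hZ hP NH (Cu.thetaEnvTower τ hC hS) (ContinuousMulEquiv.refl
    _)).galoisSurj (R N).AN.base (R N).αData.isGalois ((ContinuousMulEquiv.refl _) y)).hom (ModelFrobenioid.div (R N).pair.den) =
    ModelFrobenioid.div (R N).pair.den)
  (α : ∀ {N N' : ℕ+}, (N : ℕ) ∣ N' → ((R N').AN ⟶ (R N).AN))
  (β : ∀ {N N' : ℕ+}, (N : ℕ) ∣ N' → ((R N').BN ⟶ (R N).BN))
  (comm_sCap : ∀ {N N' : ℕ+} (hd : (N : ℕ) ∣ N'), (R N').pair.num ≫ β hd = α hd ≫ (R N).pair.num)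
  (comm_sCup : ∀ {N N' : ℕ+} (hd : (N : ℕ) ∣ N'), (R N').pair.den ≫ β hd = α hd ≫ (R N).pair.den)
  (isIsometry_α : ∀ {N N' : ℕ+} (hd : (N : ℕ) ∣ N'), ((BiKummerSetting.mkOfConnectedTemperoidYddTower (Cu.temperedArithmeticGroup e') tf hZ hP NH
    (Cu.thetaEnvTower τ hC hS) (ContinuousMulEquiv.refl _)).sec5Stub h).pre.IsIsometry (α hd))
  (degFr_α : ∀ {N N' : ℕ+} (hd : (N : ℕ) ∣ N'), (((BiKummerSetting.mkOfConnectedTemperoidYddTower (Cu.temperedArithmeticGroup e') tf hZ hP NH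
    (Cu.thetaEnvTower τ hC hS) (ContinuousMulEquiv.refl _)).sec5Stub h).pre.degFr (α hd) : ℕ) * N = N')
  (isIsometry_β : ∀ {N N' : ℕ+} (hd : (N : ℕ) ∣ N'), ((BiKummerSetting.mkOfConnectedTemperoidYddTower (Cu.temperedArithmeticGroup e') tf hZ hP NH
    (Cu.thetaEnvTower τ hC hS) (ContinuousMulEquiv.refl _)).sec5Stub h).pre.IsIsometry (β hd))
  (degFr_β : ∀ {N N' : ℕ+} (hd : (N : ℕ) ∣ N'), (((BiKummerSetting.mkOfConnectedTemperoidYddTower (Cu.temperedArithmeticGroup e') tf hZ hP NH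
    (Cu.thetaEnvTower τ hC hS) (ContinuousMulEquiv.refl _)).sec5Stub h).pre.degFr (β hd) : ℕ) * N = N')
  (baseFrob_α : ∀ {N N' : ℕ+} (hd : (N : ℕ) ∣ N'), (BiKummerSetting.mkOfConnectedTemperoidYddTower (Cu.temperedArithmeticGroup e') tf hZ hP NH
    (Cu.thetaEnvTower τ hC hS) (ContinuousMulEquiv.refl _)).IsOfBaseFrobeniusType (α hd))
  (h44 : BiKummerSetting.Thm44Hyp (BiKummerSetting.mkOfConnectedTemperoidYddTower (Cu.temperedArithmeticGroup e') tf hZ hP NH (Cu.thetaEnvTower τ hC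
    hS) (ContinuousMulEquiv.refl _)) (BiKummerSetting.mkOfConnectedTemperoidYddTower (Cu.temperedArithmeticGroup e') tf hZ hP NH (Cu.thetaEnvTower τ
    hC hS) (ContinuousMulEquiv.refl _)))
  (ψ : ∀ A : (BiKummerSetting.mkOfConnectedTemperoidYddTower (Cu.temperedArithmeticGroup e') tf hZ hP NH (Cu.thetaEnvTower τ hC hS)
    (ContinuousMulEquiv.refl _)).C, (BiKummerSetting.mkOfConnectedTemperoidYddTower (Cu.temperedArithmeticGroup e') tf hZ hP NH (Cu.thetaEnvTower τ
    hC hS) (ContinuousMulEquiv.refl _)).biratUnits A ≃* (BiKummerSetting.mkOfConnectedTemperoidYddTower (Cu.temperedArithmeticGroup e') tf hZ hP NH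
    (Cu.thetaEnvTower τ hC hS) (ContinuousMulEquiv.refl _)).biratUnits (h44.Ψ.functor.obj A))
  (hpull : ∀ {A A' : (BiKummerSetting.mkOfConnectedTemperoidYddTower (Cu.temperedArithmeticGroup e') tf hZ hP NH (Cu.thetaEnvTower τ hC hS)
    (ContinuousMulEquiv.refl _)).C} (φ : A' ⟶ A) (f : (BiKummerSetting.mkOfConnectedTemperoidYddTower (Cu.temperedArithmeticGroup e') tf hZ hP NH
    (Cu.thetaEnvTower τ hC hS) (ContinuousMulEquiv.refl _)).biratUnits A), ψ A' (pullFrac φ f) = pullFrac (h44.Ψ.functor.map φ) (ψ A f))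
  (hii : BiKummerSetting.Thm44_ii h44 ψ) (h3 : h44.PreservesFrobeniusStructure) (h4b : h44.PreservesBaseFrobeniusTypeData)
  (h8 : h44.PreservesAmple) (h15a : h44.PreservesFixedByHA ψ) (h15 : h44.PreservesSaturated ψ)
  (D : ∀ N : ℕ+, (BiKummerSetting.mkOfConnectedTemperoidYddTower (Cu.temperedArithmeticGroup e') tf hZ hP NH (Cu.thetaEnvTower τ hC hS)
    (ContinuousMulEquiv.refl _)).BaseFrobeniusTypeData (α (one_dvd_level N)))

-- The core `unusedSectionVars` linter needs ≈ 12 min on this one declaration (measured 2026-08-27: 773 s with it, 73 s without; every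
-- included section variable IS consumed by the `exact` below, which the kernel checks) — disabled for this declaration for wall time only.
set_option linter.unusedSectionVars false in
include hX₀ h hc₀ ht comm_sCap comm_sCup isIsometry_α degFr_α isIsometry_β degFr_β hpull hii h3 h4b h8 h15a h15 D in
/-- **[EtTh] Theorem 5.7 — FINAL KNIT v7 at the tower OF THE SETTING, Thm. 5.6 at each member BY NAME** (canonical vocabulary, (C) from the étale
side with separation exponent `2·l`, MLF constants, `hinvp` from the kernel): abc-iut-L2-d4's `…_of_mlf_of_kernel_of_hsepPow_hK4famE′` (p511909)
with the dictionary identification PINNED to the identity (`hιid`), `γ_μ` INDUCED by `γ` (`hind`; glue laws from p510157), and its member binder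
PRODUCED by `hK4famE'_of_shadow_byName` from the K4 junction book BY NAME + «Thm 5.6 at the transport» + residual (3).  Every other binder VERBATIM.
[cite: MochizukiEtTh2009, Thm 5.7 p.329–330 (PDF pp.103–104); Thm 5.6 p.328–329 (PDF pp.102–103); Cor 2.19 (iii) p.291 (PDF p.65); Cor 2.18 (i) p.286 (PDF p.60)] -/
theorem thetaRootPreservedAll_ofThetaSettingYddFamily_final_v7_byName_of_hsepPow
    (T : ThetaFrobenioidTower.{0} (BiKummerSetting.mkOfConnectedTemperoidYddTower (Cu.temperedArithmeticGroup e') tf hZ hP NH (Cu.thetaEnvTower τ hC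
      hS) (ContinuousMulEquiv.refl _)).C (ConnectedPart (BTemp (Cu.temperedArithmeticGroup e').Pi)))
    (hT : T = ofThetaSettingFamily τ hC hS h Q R K' (fun N => (Units.map (tf.ratFnFunctor.map (t N).op).hom).comp c₀) (fun N =>
      tf.unitsMap_comp_injective (t N) hc₀ (ht N)) hinvc (hinvp_family_ofConnectedTemperoidYddTower h R)
      α β comm_sCap comm_sCup isIsometry_α degFr_α isIsometry_β degFr_β baseFrob_α)
    -- (A) Lemma 5.8's geometric connectedness at EVERY level `N`: «a unit of `B_N` commuting with `s^⊓-gp_N(Im Π^tp_Y̲)` is a constant»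
    -- (displayed; its level-1 instance is what v1–v5 discharged from the ONE `ConstantsDictionary` junction binder)
    (hgc : ∀ (N : ℕ+) (u : (T.atLevel N).units (T.BN N)),
      (∀ y ∈ (T.atLevel N).imPiY, T.sgpCap N y * (u : Aut (T.BN N)) * (T.sgpCap N y)⁻¹ = u) →
        (T.atLevel N).unitsToBirat (T.BN N) u ∈ (T.constEmb N).range)
    {Dcnst : Type u₁} [Category.{v₁} Dcnst] (cnst : D₀ ⥤ Dcnst)
    (G : ConnectedPart (BTemp (Field.absoluteGaloisGroup DS.K)) ⥤ Dcnst)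
    (ecn : tf.base ⋙ cnst ≅ QuasiTemperoid.pushforward (Cu.temperedArithmeticGroup e').aug.toMonoidHom (Cu.temperedArithmeticGroup
      e').aug_surjective (Cu.temperedArithmeticGroup e').augIsOpenMap_holds ⋙ G)
    (hP34 : RealifiedDivisorMonoids.Prop34Cnst T₀ cnst)
    (hF : ∀ {B B' : (BiKummerSetting.mkOfConnectedTemperoidYddTower (Cu.temperedArithmeticGroup e') tf hZ hP NH (Cu.thetaEnvTower τ hC hS)
      (ContinuousMulEquiv.refl _)).C} (φ : B' ⟶ B) (y : (BiKummerSetting.mkOfConnectedTemperoidYddTower (Cu.temperedArithmeticGroup e') tf hZ hP NH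
      (Cu.thetaEnvTower τ hC hS) (ContinuousMulEquiv.refl _)).biratUnits B), pullFrac φ y = tf.pullFracModel φ y)
    (hαover : ∀ N : ℕ+, α (one_dvd_level N) ≫ (R 1).α = (R N).α)
    (hcharAN : ∀ N : ℕ+, IsTopCharacteristic (Cu.temperedArithmeticGroup e').Pi (galoisSurjOf (Cu.temperedArithmeticGroup e').isTempered (R
      N).AN.base.obj (R N).αData.isGalois).ker)
    (hdivA : ∀ αA : h44.Ψ.functor.obj (T.AN 1) ≅ T.AN 1, ∃ ε : Aut (T.AN 1), T.pre.div (αA.inv ≫ h44.Ψ.functor.map (T.sCap 1)) = T.pre.div (ε.hom ≫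
      T.sCap 1) ∧ T.pre.div (αA.inv ≫ h44.Ψ.functor.map (T.sCup 1)) = T.pre.div (ε.hom ≫ T.sCup 1))
    {N' : ℕ+} (μ' : DS.CyclotomeMod l' N') (h15iii : DS.Prop15iii ES hC) (L : Cu.CuspLabels)
    (h218i : (Cu.rigidData μ' hC hS h15iii L).Cor218_i)
    (hL : ∀ (A'' : (BiKummerSetting.mkOfConnectedTemperoidYddTower (Cu.temperedArithmeticGroup e') tf hZ hP NH (Cu.thetaEnvTower τ hC hS)
      (ContinuousMulEquiv.refl _)).C) (N : ℕ+) (g : A''.base ⟶ (R 1).AN.base) (ξ : tf.ratFnFunctor.obj (op (R 1).AN.base)),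
      (BiKummerSetting.mkOfConnectedTemperoidYddTower (Cu.temperedArithmeticGroup e') tf hZ hP NH (Cu.thetaEnvTower τ hC hS)
      (ContinuousMulEquiv.refl _)).IsFrobeniusTrivial A'' → (BiKummerSetting.mkOfConnectedTemperoidYddTower (Cu.temperedArithmeticGroup e') tf hZ
      hP NH (Cu.thetaEnvTower τ hC hS) (ContinuousMulEquiv.refl _)).IsNHSaturatedBsFld (BiKummerSetting.mkOfConnectedTemperoidYddTower
      (Cu.temperedArithmeticGroup e') tf hZ hP NH (Cu.thetaEnvTower τ hC hS) (ContinuousMulEquiv.refl _)).HodotBsFld A'' N →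
      divB tf.divisorMonoid tf.ratFnFunctor tf.divBNatTrans (op (R 1).AN.base) ξ = 1 → ∃ ζ : tf.ratFnFunctor.obj (op A''.base), ζ ^ (N : ℕ) =
      pull tf.ratFnFunctor g ξ)
    (h58N : ∀ (N : ℕ+) (c : K'ˣ), ∃ r : tf.biratUnitsModel (R N).BN,
      (r : tf.ratFnFunctor.obj (op (R N).BN.base)) ^ (N : ℕ) = (tf.ratFnFunctor.map (t N).op).hom (c₀ c : tf.ratFnFunctor.obj (op X₀)))
    -- (C) SUPPLIED BY THE ÉTALE SIDE (abc-iut-w6-d049 p478416): `⋂_N (K^×)^N = 1` (Prop 3.2 (iii)) stays displayed …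
    -- (C) Prop. 3.2 (iii) `⋂_N (K'^×)^N = 1` is NO LONGER A BINDER: `K'` is a finite extension of `ℚ_p` for the residue
    -- characteristic `p` OF THE SETTING (print p.322), and the clause is `MLFDivisible.units_eq_one_of_forall_exists_pow_eq` (p480502)
    [Algebra ℚ_[p] K'] [FiniteDimensional ℚ_[p] K']
    -- … the §5 ↔ §2 dictionary at every level `M ∈ Es` of the tower of the Setting (pins of a COMPATIBLE family `η`) …
    (ι : T.PiX ≃* (Cu.thetaEnvTower τ hC hS).PiX) (hι : ∀ y : T.PiX, y ∈ T.PiYdd ↔ ι y ∈ (Cu.thetaEnvTower τ hC hS).PiYdd)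
    -- the dictionary identification `ι` IS the identity (stated heterogeneously: the display abstracts the tower term `T`)
    (hιid : HEq ι (MulEquiv.refl (Cu.thetaEnvTower τ hC hS).PiX))
    (m : ∀ M : Es, (T.atLevel M).muTorsion (T.atLevel M).BN (T.atLevel M).N ≃* ((Cu.thetaEnvTower τ hC hS).level M).mu)
    (hχ : ∀ M : Es, (T.atLevel M).CyclotomicCharacterCompat ((Cu.thetaEnvTower τ hC hS).level M) ι (m M))
    (HF : ∀ M : Es, (T.atLevel M).Facts)
    (η : ∀ M : Es, (Cu.thetaEnvTower τ hC hS).PiYdd → (Cu.thetaEnvTower τ hC hS).mu M)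
    (hη : ∀ M, η M ∈ (Cu.thetaEnvTower τ hC hS).thetaCocycles M)
    (hηc : ∀ (M M' : Es) (hd : (M : ℕ+) ∣ M'), (Cu.thetaEnvTower τ hC hS).red M M' hd ∘ η M' = η M)
    (hpin : ∀ M : Es, (T.atLevel M).ThetaSectionCompat (HF M) ((Cu.thetaEnvTower τ hC hS).level M) ι (m M) hι (η M))
    -- … the étale data on the tower: `(γ, γ_μ)` with F-0652's conclusion SHAPE, glue, translation-freeness, separation across levels …
    (γ : (Cu.thetaEnvTower τ hC hS).PiX ≃ₜ* (Cu.thetaEnvTower τ hC hS).PiX)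
    (hγ : (Cu.thetaEnvTower τ hC hS).PiYdd.map γ.toMulEquiv.toMonoidHom = (Cu.thetaEnvTower τ hC hS).PiYdd)
    (hγ' : ∀ x : (Cu.thetaEnvTower τ hC hS).PiX, x ∈ (Cu.thetaEnvTower τ hC hS).PiYdd → γ x ∈ (Cu.thetaEnvTower τ hC hS).PiYdd)
    (γμ : ∀ M : Es, (Cu.thetaEnvTower τ hC hS).mu M ≃* (Cu.thetaEnvTower τ hC hS).mu M)
    (hstd : ∃ cf : ∀ M : Es, (Cu.thetaEnvTower τ hC hS).G → (Cu.thetaEnvTower τ hC hS).mu M,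
      (∀ M, CycEnvelope.IsEnvCocycle (MonoidHom.id _) ((Cu.thetaEnvTower τ hC hS).chi M) (cf M)) ∧
      (∀ M, IsLocallyConstant (cf M ∘ (Cu.thetaEnvTower τ hC hS).aug)) ∧
      (∀ (M M' : Es) (hd : (M : ℕ+) ∣ M'), (Cu.thetaEnvTower τ hC hS).red M M' hd ∘ cf M' = cf M) ∧
      (∀ M, (Cu.thetaEnvTower τ hC hS).pullbackCocycle M γ hγ (γμ M) '' (Cu.thetaEnvTower τ hC hS).thetaCocycles M =
        (fun η => η * (cf M ∘ (Cu.thetaEnvTower τ hC hS).aug ∘ (Cu.thetaEnvTower τ hC hS).PiYdd.subtype)) ''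
          (Cu.thetaEnvTower τ hC hS).thetaCocycles M) ∧
      ∀ M : Es, ∃ d : (Cu.thetaEnvTower τ hC hS).mu M, ∀ g : (Cu.thetaEnvTower τ hC hS).G,
        cf M g ^ T.l = CycEnvelope.coboundary (MonoidHom.id _) ((Cu.thetaEnvTower τ hC hS).chi M) d g)
    -- `γ_μ` INDUCED by `γ` on `(l·Δ_Θ) ⊗ ℤ/M` through `thetaMod` (Cor. 2.19 (iii)'s hypothesis shape; `hγμχ`, `hγμred` are THEOREMS, p510157)
    (hind : ∀ (M : Es) (g : (Cu.thetaEnvTower τ hC hS).lDeltaTheta) (hg : γ g ∈ (Cu.thetaEnvTower τ hC hS).lDeltaTheta),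
      (Cu.thetaEnvTower τ hC hS).thetaMod M ⟨γ g, hg⟩ = γμ M ((Cu.thetaEnvTower τ hC hS).thetaMod M g))
    (haug : ∀ x y : (Cu.thetaEnvTower τ hC hS).PiX, (Cu.thetaEnvTower τ hC hS).aug x = (Cu.thetaEnvTower τ hC hS).aug y →
      (Cu.thetaEnvTower τ hC hS).aug (γ x) = (Cu.thetaEnvTower τ hC hS).aug (γ y))
    (hinfη : ∀ (M : Es) (k k' : (Cu.thetaEnvTower τ hC hS).PiYdd), (Cu.thetaEnvTower τ hC hS).aug k = (Cu.thetaEnvTower τ hC hS).aug k' →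
      (η M k)⁻¹ * γμ M (η M ⟨γ.symm k, (Cu.thetaEnvTower τ hC hS).symm_apply_mem_PiYdd_of_map_eq γ hγ k k.2⟩) =
        (η M k')⁻¹ * γμ M (η M ⟨γ.symm k', (Cu.thetaEnvTower τ hC hS).symm_apply_mem_PiYdd_of_map_eq γ hγ k' k'.2⟩))
    -- separation across levels, REPAIRED exponent `2·l` (abc-iut-f-123's `hsep^{(2l)}`, p498016 / p504774)
    (hsep : ∀ η' : ∀ M : Es, (Cu.thetaEnvTower τ hC hS).PiYdd → (Cu.thetaEnvTower τ hC hS).mu M,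
      (∀ M, η' M ∈ (Cu.thetaEnvTower τ hC hS).thetaCocycles M) →
      (∀ (M M' : Es) (hd : (M : ℕ+) ∣ M'), (Cu.thetaEnvTower τ hC hS).red M M' hd ∘ η' M' = η' M) →
      (∀ (M : Es) (k k' : (Cu.thetaEnvTower τ hC hS).PiYdd), (Cu.thetaEnvTower τ hC hS).aug k = (Cu.thetaEnvTower τ hC hS).aug k' →
        η' M k * (η M k)⁻¹ = η' M k' * (η M k')⁻¹) →
      ∀ M : Es, ∃ d : (Cu.thetaEnvTower τ hC hS).mu M, ∀ k : (Cu.thetaEnvTower τ hC hS).PiYdd,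
        (η' M k * (η M k)⁻¹) ^ (2 * T.l) =
          CycEnvelope.coboundary ((Cu.thetaEnvTower τ hC hS).aug.comp (Cu.thetaEnvTower τ hC hS).PiYdd.subtype)
            ((Cu.thetaEnvTower τ hC hS).chi M) d k)
    -- … THE K4 JUNCTION BOOK BY NAME (Thm. 5.6's inputs) at every level `M` on the §5 datum over the LEVEL-`M` RIGIDITY DATA (v2 subquotient record +
    -- two pins, Kummer-determined rigidity family with `B_M` theta-saturated AT THE LEVEL STUB — displayed —, the Δ-transport of `Ψ`), «Thm. 5.6 at
    -- the transport» per member (`hT56`), and residual (3) for every PRODUCED base shadow (`hK4famS`, verbatim) …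
    {Gal : ConnectedPart (BTemp (Cu.temperedArithmeticGroup e').Pi) → Prop}
    (P : ∀ M : Es, ThetaSubquotientProjGalois (ThetaFrobenioid.ofConnectedTemperoidData (T := (Cu.rigidData (τ.mod M) hC hS h15iii L).toThetaEnvData) h
          ((Cu.rigidData (τ.mod M) hC hS h15iii L).levelStub (ContinuousMulEquiv.refl (Cu.temperedArithmeticGroup e').Pi)) Cu.odd_lPNat (R M)
          (ContinuousMulEquiv.refl (Cu.temperedArithmeticGroup e').Pi) K' ((Units.map (tf.ratFnFunctor.map (t M).op).hom).comp c₀)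
          (tf.unitsMap_comp_injective (t M) hc₀ (ht M)) (hinvc M) (hinvp_family_ofConnectedTemperoidYddTower h R M)) Gal)
    (hPpre : ∀ M : Es, (P M).pre (R M).BN.base =
      (ThetaSubquotient.autPre ((Cu.rigidData (τ.mod M) hC hS h15iii L).qN (ContinuousMulEquiv.refl (Cu.temperedArithmeticGroup e').Pi))
        (Cu.rigidData (τ.mod M) hC hS h15iii L).iotaN (R M).BN.base.obj).comap
          (Functor.mapAut (R M).BN.base (connectedObjects (BTemp (Cu.temperedArithmeticGroup e').Pi)).ι))
    (hPproj_pin : ∀ M : Es, haveI := (Cu.rigidData (τ.mod M) hC hS h15iii L).iotaN_range_normal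
      ∀ (σ : (P M).pre (R M).BN.base)
        (t' : ThetaSubquotient.autPre ((Cu.rigidData (τ.mod M) hC hS h15iii L).qN (ContinuousMulEquiv.refl (Cu.temperedArithmeticGroup e').Pi))
          (Cu.rigidData (τ.mod M) hC hS h15iii L).iotaN (R M).BN.base.obj),
        Functor.mapAut (R M).BN.base (connectedObjects (BTemp (Cu.temperedArithmeticGroup e').Pi)).ι (σ : Aut (R M).BN.base) =
            (t' : Aut (R M).BN.base.obj) →
          (((P M).proj (R M).BN.base σ : ThetaSubquotient.LDelta ((Cu.rigidData (τ.mod M) hC hS h15iii L).qN (ContinuousMulEquiv.refl (Cu.temperedArithmeticGroup e').Pi))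
              (Cu.rigidData (τ.mod M) hC hS h15iii L).iotaN (R M).BN.base.obj)) =
            ThetaSubquotient.autProj ((Cu.rigidData (τ.mod M) hC hS h15iii L).qN (ContinuousMulEquiv.refl (Cu.temperedArithmeticGroup e').Pi))
              (Cu.rigidData (τ.mod M) hC hS h15iii L).iotaN (R M).BN.base.obj t')
    (ρK : ∀ M : Es, RigidityFamily (ThetaFrobenioid.ofConnectedTemperoidData (T := (Cu.rigidData (τ.mod M) hC hS h15iii L).toThetaEnvData) h
          ((Cu.rigidData (τ.mod M) hC hS h15iii L).levelStub (ContinuousMulEquiv.refl (Cu.temperedArithmeticGroup e').Pi)) Cu.odd_lPNat (R M)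
          (ContinuousMulEquiv.refl (Cu.temperedArithmeticGroup e').Pi) K' ((Units.map (tf.ratFnFunctor.map (t M).op).hom).comp c₀)
          (tf.unitsMap_comp_injective (t M) hc₀ (ht M)) (hinvc M) (hinvp_family_ofConnectedTemperoidYddTower h R M)))
    (hB : ∀ M : Es, (ThetaFrobenioid.ofConnectedTemperoidData (T := (Cu.rigidData (τ.mod M) hC hS h15iii L).toThetaEnvData) h
          ((Cu.rigidData (τ.mod M) hC hS h15iii L).levelStub (ContinuousMulEquiv.refl (Cu.temperedArithmeticGroup e').Pi)) Cu.odd_lPNat (R M)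
          (ContinuousMulEquiv.refl (Cu.temperedArithmeticGroup e').Pi) K' ((Units.map (tf.ratFnFunctor.map (t M).op).hom).comp c₀)
          (tf.unitsMap_comp_injective (t M) hc₀ (ht M)) (hinvc M) (hinvp_family_ofConnectedTemperoidYddTower h R M)).IsThetaSaturated (R M).BN)
    (hKD : ∀ M : Es, (P M).IsKummerDetermined (ρK M) (hB M))
    (aΨ : ∀ (M : Es) (S), (ThetaFrobenioid.ofConnectedTemperoidData (T := (Cu.rigidData (τ.mod M) hC hS h15iii L).toThetaEnvData) h
          ((Cu.rigidData (τ.mod M) hC hS h15iii L).levelStub (ContinuousMulEquiv.refl (Cu.temperedArithmeticGroup e').Pi)) Cu.odd_lPNat (R M)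
          (ContinuousMulEquiv.refl (Cu.temperedArithmeticGroup e').Pi) K' ((Units.map (tf.ratFnFunctor.map (t M).op).hom).comp c₀)
          (tf.unitsMap_comp_injective (t M) hc₀ (ht M)) (hinvc M) (hinvp_family_ofConnectedTemperoidYddTower h R M)).lDeltaModN S ≃* (ThetaFrobenioid.ofConnectedTemperoidData (T := (Cu.rigidData (τ.mod M) hC hS h15iii L).toThetaEnvData) h
          ((Cu.rigidData (τ.mod M) hC hS h15iii L).levelStub (ContinuousMulEquiv.refl (Cu.temperedArithmeticGroup e').Pi)) Cu.odd_lPNat (R M)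
          (ContinuousMulEquiv.refl (Cu.temperedArithmeticGroup e').Pi) K' ((Units.map (tf.ratFnFunctor.map (t M).op).hom).comp c₀)
          (tf.unitsMap_comp_injective (t M) hc₀ (ht M)) (hinvc M) (hinvp_family_ofConnectedTemperoidYddTower h R M)).lDeltaModN (h44.Ψ.functor.obj S))
    (hT56 : ∀ (M : Es) (a : h44.Ψ.functor.obj (R M).AN ≅ (R M).AN) (b : h44.Ψ.functor.obj (R M).BN ≅ (R M).BN) (w : Aut (R M).BN),
      w ∈ ((BiKummerSetting.mkOfConnectedTemperoidYddTower (Cu.temperedArithmeticGroup e') tf hZ hP NH (Cu.thetaEnvTower τ hC hS)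
          (ContinuousMulEquiv.refl _)).sec5Stub h).pre.unitsSubgroup (R M).BN →
      a.inv ≫ h44.Ψ.functor.map (R M).pair.num ≫ b.hom = (R M).pair.num →
      a.inv ≫ h44.Ψ.functor.map (R M).pair.den ≫ b.hom = (R M).pair.den ≫ w.hom →
        ∃ θ' : Aut (R M).BN.base ≃* Aut (R M).BN.base,
          ThetaFrobenioid.Thm56Sub.DeltaTransportCompatGal (ThetaFrobenioid.ofConnectedTemperoidData (T := (Cu.rigidData (τ.mod M) hC hS h15iii L).toThetaEnvData) h
          ((Cu.rigidData (τ.mod M) hC hS h15iii L).levelStub (ContinuousMulEquiv.refl (Cu.temperedArithmeticGroup e').Pi)) Cu.odd_lPNat (R M)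
          (ContinuousMulEquiv.refl (Cu.temperedArithmeticGroup e').Pi) K' ((Units.map (tf.ratFnFunctor.map (t M).op).hom).comp c₀)
          (tf.unitsMap_comp_injective (t M) hc₀ (ht M)) (hinvc M) (hinvp_family_ofConnectedTemperoidYddTower h R M)) h44.Ψ b (aΨ M) θ' (P M) ∧
          (∀ y, (ThetaFrobenioid.ofConnectedTemperoidData (T := (Cu.rigidData (τ.mod M) hC hS h15iii L).toThetaEnvData) h
          ((Cu.rigidData (τ.mod M) hC hS h15iii L).levelStub (ContinuousMulEquiv.refl (Cu.temperedArithmeticGroup e').Pi)) Cu.odd_lPNat (R M)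
          (ContinuousMulEquiv.refl (Cu.temperedArithmeticGroup e').Pi) K' ((Units.map (tf.ratFnFunctor.map (t M).op).hom).comp c₀)
          (tf.unitsMap_comp_injective (t M) hc₀ (ht M)) (hinvc M) (hinvp_family_ofConnectedTemperoidYddTower h R M)).psiAut h44.Ψ b (ρK M (R M).BN (hB M) y).1 =
            (ρK M (R M).BN (hB M) ((ThetaFrobenioid.ofConnectedTemperoidData (T := (Cu.rigidData (τ.mod M) hC hS h15iii L).toThetaEnvData) h
          ((Cu.rigidData (τ.mod M) hC hS h15iii L).levelStub (ContinuousMulEquiv.refl (Cu.temperedArithmeticGroup e').Pi)) Cu.odd_lPNat (R M)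
          (ContinuousMulEquiv.refl (Cu.temperedArithmeticGroup e').Pi) K' ((Units.map (tf.ratFnFunctor.map (t M).op).hom).comp c₀)
          (tf.unitsMap_comp_injective (t M) hc₀ (ht M)) (hinvc M) (hinvp_family_ofConnectedTemperoidYddTower h R M)).lDeltaModNMap b.hom (aΨ M (R M).BN y))).1) ∧
          ∀ k : (Cu.thetaEnvTower τ hC hS).PiYdd,
            θ' ((ofThetaSettingFamily τ hC hS h Q R K' (fun N => (Units.map (tf.ratFnFunctor.map (t N).op).hom).comp c₀)
          (fun N => tf.unitsMap_comp_injective (t N) hc₀ (ht N)) hinvc (hinvp_family_ofConnectedTemperoidYddTower h R) α β comm_sCap comm_sCup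
          isIsometry_α degFr_α isIsometry_β degFr_β baseFrob_α).ρ M (k : (Cu.thetaEnvTower τ hC hS).PiX)) =
              (ofThetaSettingFamily τ hC hS h Q R K' (fun N => (Units.map (tf.ratFnFunctor.map (t N).op).hom).comp c₀)
          (fun N => tf.unitsMap_comp_injective (t N) hc₀ (ht N)) hinvc (hinvp_family_ofConnectedTemperoidYddTower h R) α β comm_sCap comm_sCup
          isIsometry_α degFr_α isIsometry_β degFr_β baseFrob_α).ρ M (γ (k : (Cu.thetaEnvTower τ hC hS).PiX)))
    (hK4famS : ∀ (α₁ : h44.Ψ.functor.obj (T.AN 1) ≅ T.AN 1) (β₁ : h44.Ψ.functor.obj (T.BN 1) ≅ T.BN 1) (u₁ : Aut (T.BN 1))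
      (hu₁ : u₁ ∈ (T.atLevel 1).units (T.BN 1)),
      α₁.inv ≫ h44.Ψ.functor.map (T.sCap 1) ≫ β₁.hom = T.sCap 1 →
      α₁.inv ≫ h44.Ψ.functor.map (T.sCup 1) ≫ β₁.hom = T.sCup 1 ≫ u₁.hom →
      ∀ c : T.Kˣ, (T.atLevel 1).unitsToBirat (T.BN 1) ⟨u₁, hu₁⟩ = T.constEmb 1 c →
      ∀ N (hN : N ∈ Es), ∀ (a : h44.Ψ.functor.obj (T.AN N) ≅ T.AN N) (b : h44.Ψ.functor.obj (T.BN N) ≅ T.BN N) (w : Aut (T.BN N)),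
        w ∈ (T.atLevel N).units (T.BN N) →
        a.inv ≫ h44.Ψ.functor.map (T.sCap N) ≫ b.hom = T.sCap N →
        a.inv ≫ h44.Ψ.functor.map (T.sCup N) ≫ b.hom = T.sCup N ≫ w.hom →
        a.inv ≫ h44.Ψ.functor.map (T.α (one_dvd_level N)) ≫ α₁.hom = T.α (one_dvd_level N) →
        b.inv ≫ h44.Ψ.functor.map (T.β (one_dvd_level N)) ≫ β₁.hom = T.β (one_dvd_level N) →
          ∀ (θb : Aut (T.pre.base.obj (T.BN N)) ≃* Aut (T.pre.base.obj (T.BN N))) (e : T.AN N ≅ T.AN N),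
            e ∈ (T.atLevel N).units (T.AN N) → ∀ Dc Dp : Aut (T.BN N),
            a.inv ≫ h44.Ψ.functor.map (T.sCap N) ≫ (b ≪≫ Dc.symm).hom = e.hom ≫ T.sCap N ≫ (1 : Aut (T.BN N)).hom →
            a.inv ≫ h44.Ψ.functor.map (T.sCup N) ≫ (b ≪≫ Dc.symm).hom = e.hom ≫ T.sCup N ≫ Dp.hom →
            Dp ∈ (T.atLevel N).units (T.BN N) → (T.atLevel N).StrvTransport h44.Ψ a e θb →
            (T.atLevel N).HB.map θb.toMonoidHom = (T.atLevel N).HB →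
              ∀ k : T.PiYdd, θb (T.ρ N k) = T.ρ N (ι.symm (γ (ι k))))
 :
    T.ThetaRootPreservedAll h44.Ψ := by
  -- the member binder first, WITHOUT expected type (its implicit arguments are then solved first-order from its explicit ones;
  -- elaborating it against the knit's binder type instead costs ≈ 15 min of def-chain unfolding — abc-iut-L2-t4's p519096 note, lever (t3))
  have hfam := hK4famE'_of_shadow_byName Cu τ hC hS h Q R K' t c₀ hc₀ ht hinvc α β comm_sCap comm_sCup isIsometry_α degFr_α isIsometry_β degFr_β
    baseFrob_α h15iii L μ' h218i h44.Ψ T hT ι hι hιid m HF η hη hpin γ γμ hind P hPpre hPproj_pin ρK hB hKD aΨ hT56 hK4famS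
  exact thetaRootPreservedAll_ofThetaSettingYddFamily_final_v6_treeMonoidVocab_of_cor219iiiStd_of_mlf_of_kernel_of_hsepPow_hK4famE' Cu τ hC hS
    h Q R K' hX₀ t c₀ hc₀ ht hinvc α β comm_sCap comm_sCup isIsometry_α degFr_α isIsometry_β degFr_β baseFrob_α h44 ψ hpull hii h3 h4b h8 h15a h15 D
    T hT hgc cnst G ecn hP34 hF hαover hcharAN hdivA μ' h15iii L h218i hL h58N ι hι m hχ HF η hη hηc hpin γ hγ hγ' γμ hstd
    (Cu.hγμχ_thetaEnvTower_of_induced τ hC hS γ γμ (Cu.map_lDeltaTheta_thetaEnvTower_of_cor218i τ hC hS h15iii L μ' h218i γ) hind)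
    (Cu.hγμred_thetaEnvTower_of_induced τ hC hS γ γμ (Cu.map_lDeltaTheta_thetaEnvTower_of_cor218i τ hC hS h15iii L μ' h218i γ) hind) haug hinfη
    hsep hfam

end Setting

end ThetaFrobenioidTower

end Literature.AnabelianGeometry.EtaleTheta

end
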